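import Summits.CriticalPhenomena.SAWScalingLimit.Theorems.SAWLoopFugacityFlowAvoidanceLimitHarnackChainDefs
import Summits.CriticalPhenomena.SAWScalingLimit.Theorems.SAWLoopFugacityFlowAvoidanceLimitGreenRatioDecomposition
import HarnessLib

/-!
# Bookkeeping of the boundary Harnack chain (line `symplectic-fermion-anchor`, crux
`SAWLoopFugacityFlow.AvoidanceLimit`, stmt-CriticalPhenomena-10649; lead c4)

The chain sets of `Theorems/SAWLoopFugacityFlowAvoidanceLimitHarnackChainDefs.lean`
(`farTheta ⊇ farCluster`, `chainS = farCluster ∪ exits`, `chainR` = `Λ`-interior of `chainS`) satisfy the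
three structural hypotheses of the lattice adapter `transitionHarmonic_crossDiff_iterate_exit`
(`Theorems/SAWLoopFugacityFlowAvoidanceLimitCrossDiffAdapter.lean`) along decreasing radii:

* `farTheta_mono`, `farCluster_mono` — monotonicity in the radius;
* `chainS_subset_farCluster_of_le` — one lattice step of margin: `chainS (σ') ⊆ farCluster (σ)` once
  `σ' + δ ≤ σ` (an exit vertex of the `σ'`-cluster is adjacent to a cluster vertex INSIDE `B(p, σ')`,
  because a cluster vertex outside that ball adjacent to an escaping vertex would escape);
* `farCluster_subset_chainR` — the cluster lies in the interior of `chainS`; hence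
  `chainS_subset_chainR_of_le : chainS (σ') ⊆ chainR (σ)` (the adapter's `S (j+1) ⊆ R j`);
* `dist_lt_of_mem_chainS` — every vertex of `chainS (σ)` lies within `R` of `p` once `σ + δ ≤ R` (the
  adapter's harmonicity region);
* `mem_farCluster_of_walk` — a vertex joined to the anchor by a walk of `Λ`-vertices inside `B(p, σ)`
  lies in `farCluster (σ)` (how lattice local connectivity feeds the last step `Λ ∩ B(p,r) ⊆ S q`).

All for a general subgraph `H ≤ ℤ²` and volume `Λ`. Folklore set bookkeeping; no new definitions.
-/

noncomputable section

open scoped BigOperators Classical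
open Finset
open Literature.Probability.RandomPlanarGeometry Literature.Probability.LatticeModels

namespace Summit.CriticalPhenomena.SAWScalingLimit.Theorems.AvoidanceLimit.Anchor

variable {H : SimpleGraph (Site 2)} {Λ : Finset (Site 2)} {δ : ℝ} {p : ℂ} {R : ℝ}

/-- Far escape is antitone in the avoided radius: escaping while avoiding `B(p, σ)` escapes while
avoiding the smaller `B(p, σ')`, `σ' ≤ σ`. [folklore] -/
theorem FarEscape.mono {σ σ' : ℝ} (hσ : σ' ≤ σ) {v : Site 2} (h : FarEscape H δ p R σ v) :
    FarEscape H δ p R σ' v := by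
  obtain ⟨y, w, hy, hw⟩ := h
  exact ⟨y, w, hy, fun z hz => hσ.trans (hw z hz)⟩

/-- `Θ` is monotone in the radius: `farTheta σ' ⊆ farTheta σ` for `σ' ≤ σ`. [folklore] -/
theorem farTheta_mono {σ σ' : ℝ} (hσ : σ' ≤ σ) : farTheta H Λ δ p R σ' ⊆ farTheta H Λ δ p R σ := by
  intro v hv
  rw [mem_farTheta_iff] at hv ⊢
  exact ⟨hv.1, fun h => hv.2 (h.mono hσ)⟩

/-- The anchored cluster is monotone in the radius. [folklore] -/
theorem farCluster_mono {σ σ' : ℝ} (hσ : σ' ≤ σ) (a₀ : Site 2) :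
    farCluster H Λ δ p R σ' a₀ ⊆ farCluster H Λ δ p R σ a₀ := by
  intro v hv
  rw [mem_farCluster_iff] at hv ⊢
  obtain ⟨hvΛ, w, hw⟩ := hv
  exact ⟨hvΛ, w, fun z hz => farTheta_mono hσ (hw z hz)⟩

/-- Extending a cluster walk by one edge inside `Θ`: an `H`-neighbour of a cluster vertex that lies in
`farTheta` lies in the cluster. [folklore] -/
theorem mem_farCluster_of_adj {σ : ℝ} {a₀ w x : Site 2} (hw : w ∈ farCluster H Λ δ p R σ a₀)
    (hadj : H.Adj w x) (hx : x ∈ farTheta H Λ δ p R σ) : x ∈ farCluster H Λ δ p R σ a₀ := by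
  rw [mem_farCluster_iff] at hw ⊢
  obtain ⟨-, q, hq⟩ := hw
  refine ⟨farTheta_subset hx, q.append (SimpleGraph.Walk.cons hadj SimpleGraph.Walk.nil), ?_⟩
  intro z hz
  rw [SimpleGraph.Walk.support_append, List.mem_append] at hz
  rcases hz with hz | hz
  · exact hq z hz
  · simp only [SimpleGraph.Walk.support_cons, SimpleGraph.Walk.support_nil, List.tail_cons,
      List.mem_singleton] at hz
    subst hz
    exact hx

/-- A vertex of `Θ(σ)` adjacent to an ESCAPING vertex lies inside the open ball `B(p, σ)` (otherwise
it would escape through that neighbour). [folklore] -/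
theorem dist_lt_of_mem_farTheta_of_adj_farEscape {σ : ℝ} {w x : Site 2}
    (hw : w ∈ farTheta H Λ δ p R σ) (hadj : H.Adj w x) (hx : FarEscape H δ p R σ x) :
    dist (meshPoint δ w) p < σ := by
  by_contra hge
  push Not at hge
  obtain ⟨y, q, hy, hq⟩ := hx
  refine (mem_farTheta_iff.1 hw).2 ⟨y, SimpleGraph.Walk.cons hadj q, hy, ?_⟩
  intro z hz
  rw [SimpleGraph.Walk.support_cons, List.mem_cons] at hz
  rcases hz with rfl | hz
  · exact hge
  · exact hq z hz

/-- **One lattice step of margin.** For `H ≤ ℤ²`, `0 ≤ δ` and radii `σ' + δ ≤ σ`: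
`chainS (σ') ⊆ farCluster (σ)` — the exits of the `σ'`-cluster are absorbed by the `σ`-cluster.
[folklore] -/
theorem chainS_subset_farCluster_of_le (hH : H ≤ zdGraph 2) (hδ : 0 ≤ δ) {σ σ' : ℝ}
    (hσ : σ' + δ ≤ σ) (a₀ : Site 2) :
    chainS H Λ δ p R σ' a₀ ⊆ farCluster H Λ δ p R σ a₀ := by
  intro x hx
  rw [mem_chainS_iff] at hx
  obtain ⟨hxΛ, hx | ⟨w, hw, hadj⟩⟩ := hx
  · exact farCluster_mono (by linarith) a₀ hx
  · by_cases hxT : x ∈ farTheta H Λ δ p R σ'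
    · exact farCluster_mono (by linarith) a₀ (mem_farCluster_of_adj hw hadj hxT)
    · -- `x` escapes at level `σ'`, so `w` sits inside `B(p, σ')` and `x` inside `B(p, σ' + δ) ⊆ B(p, σ)`
      have hxE : FarEscape H δ p R σ' x := by
        by_contra h
        exact hxT (mem_farTheta_iff.2 ⟨hxΛ, h⟩)
      have hwd : dist (meshPoint δ w) p < σ' :=
        dist_lt_of_mem_farTheta_of_adj_farEscape (farCluster_subset_farTheta hw) hadj hxE
      have hxd : dist (meshPoint δ x) p < σ := by
        have := dist_meshPoint_lt_add_of_adj hδ hwd (hH hadj)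
        linarith
      exact mem_farCluster_of_adj (farCluster_mono (by linarith) a₀ hw) hadj
        (mem_farTheta_of_dist_lt hxΛ hxd)

/-- The anchored cluster lies in the `Λ`-interior of `chainS`. [folklore] -/
theorem farCluster_subset_chainR {σ : ℝ} (a₀ : Site 2) :
    farCluster H Λ δ p R σ a₀ ⊆ chainR H Λ δ p R σ a₀ := by
  intro z hz
  rw [mem_chainR_iff]
  refine ⟨mem_chainS_iff.2 ⟨(mem_farCluster_iff.1 hz).1, Or.inl hz⟩, fun y hy hzy => ?_⟩
  exact mem_chainS_iff.2 ⟨hy, Or.inr ⟨z, hz, hzy⟩⟩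

/-- **The adapter's nesting hypothesis `S (j+1) ⊆ R j`.** For `H ≤ ℤ²`, `0 ≤ δ`, `σ' + δ ≤ σ`:
`chainS (σ') ⊆ chainR (σ)`. [folklore] -/
theorem chainS_subset_chainR_of_le (hH : H ≤ zdGraph 2) (hδ : 0 ≤ δ) {σ σ' : ℝ} (hσ : σ' + δ ≤ σ)
    (a₀ : Site 2) : chainS H Λ δ p R σ' a₀ ⊆ chainR H Λ δ p R σ a₀ :=
  (chainS_subset_farCluster_of_le hH hδ hσ a₀).trans (farCluster_subset_chainR a₀)

/-- **The adapter's harmonicity region.** For `H ≤ ℤ²`, `0 ≤ δ` and `σ + δ ≤ R`, every vertex of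
`chainS (σ)` has its mesh point within `R` of `p`. [folklore] -/
theorem dist_lt_of_mem_chainS (hH : H ≤ zdGraph 2) (hδ : 0 ≤ δ) {σ : ℝ} (hσR : σ + δ ≤ R)
    {a₀ x : Site 2} (hx : x ∈ chainS H Λ δ p R σ a₀) : dist (meshPoint δ x) p < R := by
  rw [mem_chainS_iff] at hx
  obtain ⟨hxΛ, hx | ⟨w, hw, hadj⟩⟩ := hx
  · exact dist_lt_of_mem_farTheta (by linarith) (farCluster_subset_farTheta hx)
  · by_cases hxT : x ∈ farTheta H Λ δ p R σ
    · exact dist_lt_of_mem_farTheta (by linarith) hxT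
    · have hxE : FarEscape H δ p R σ x := by
        by_contra h
        exact hxT (mem_farTheta_iff.2 ⟨hxΛ, h⟩)
      have hwd : dist (meshPoint δ w) p < σ :=
        dist_lt_of_mem_farTheta_of_adj_farEscape (farCluster_subset_farTheta hw) hadj hxE
      have := dist_meshPoint_lt_add_of_adj hδ hwd (hH hadj)
      linarith

/-- **How local lattice connectivity feeds the last step.** A vertex joined to the anchor by an
`H`-walk all of whose vertices lie in `Λ ∩ B(p, σ)` lies in `farCluster (σ)` (⊆ `chainS (σ)`).
[folklore] -/
theorem mem_farCluster_of_walk {σ : ℝ} {a₀ v : Site 2} (w : H.Walk a₀ v)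
    (hw : ∀ z ∈ w.support, z ∈ Λ ∧ dist (meshPoint δ z) p < σ) :
    v ∈ farCluster H Λ δ p R σ a₀ := by
  rw [mem_farCluster_iff]
  exact ⟨(hw v w.end_mem_support).1, w, fun z hz => mem_farTheta_of_dist_lt (hw z hz).1 (hw z hz).2⟩

/-- The cluster is contained in `chainS`. [folklore] -/
theorem farCluster_subset_chainS {σ : ℝ} (a₀ : Site 2) :
    farCluster H Λ δ p R σ a₀ ⊆ chainS H Λ δ p R σ a₀ :=
  (farCluster_subset_chainR a₀).trans chainR_subset_chainS

/-- **Registered form of the nesting** (the adapter's hypothesis `S (j+1) ⊆ R j` along the chain): for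
`H ≤ ℤ²`, `0 ≤ δ` and radii `σ' + δ ≤ σ`, `chainS (σ') ⊆ chainR (σ)`. [folklore] -/
theorem chain_nesting :
    ∀ (H : SimpleGraph (Site 2)), H ≤ zdGraph 2 → ∀ (Λ : Finset (Site 2)) (δ : ℝ) (p : ℂ) (R σ σ' : ℝ) (a₀ : Site 2),
      0 ≤ δ → σ' + δ ≤ σ → chainS H Λ δ p R σ' a₀ ⊆ chainR H Λ δ p R σ a₀ :=
  fun _ hH _ _ _ _ _ _ a₀ hδ hσ => chainS_subset_chainR_of_le hH hδ hσ a₀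

end Summit.CriticalPhenomena.SAWScalingLimit.Theorems.AvoidanceLimit.Anchor

end
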